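import Literature.Analysis.Complex.RectangleNested
import Literature.Analysis.Complex.HolomorphicParametricIntegral
import Mathlib.Analysis.SpecialFunctions.ImproperIntegrals
import Mathlib.MeasureTheory.Integral.Prod
import HarnessLib

/-!
# Rectangular contours: two holes, translation, perimeter bounds, holomorphic parameters

Topic `Literature/Analysis/Complex`. Everything here is PROVED (theorems only), in the four-term
convention `rectBoundaryIntegral F a b c d = ∫_bottom − ∫_top + i∫_right − i∫_left` of
`ArgumentPrincipleRectangle.lean`. A toolkit for residue bookkeeping on rectangles, continuing
`RectangleNested.lean` (one hole: `rectBoundaryIntegral_eq_of_differentiableOn_annulus`):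

* `rectBoundaryIntegral_eq_add_of_differentiableOn_two_holes_re` / `_im` — **two holes**: if
  `R₁, R₂ ⊆ R` are closed sub-rectangles separated by a vertical (resp. horizontal) line and `F` is
  complex differentiable on `R ∖ (R₁° ∪ R₂°)`, then `∮_{∂R} F = ∮_{∂R₁} F + ∮_{∂R₂} F`
  (cut `R` along the separating line and apply the one-hole theorem to each half);
* `rectBoundaryIntegral_comp_add` — translation: `∮_{∂R} F(z + w) dz = ∮_{∂(R + w)} F`;
* `norm_rectBoundaryIntegral_le` — the perimeter bound `‖∮_{∂R} F‖ ≤ M (2(b−a) + 2(d−c))` from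
  `‖F‖ ≤ M` on `∂R`;
* `differentiableOn_intervalIntegral_of_continuousOn`, `differentiableOn_rectBoundaryIntegral` —
  **holomorphic dependence on a parameter**: if `F p z` is holomorphic in `p ∈ U` (open) for each
  `z` on `∂R` and jointly continuous on `U × ∂R`, then `p ↦ ∮_{∂R} F p` is holomorphic on `U`
  (dominated differentiation with the Cauchy–Schwarz estimates of
  `HolomorphicParametricIntegral.lean`, edge by edge);
* `integral_Ioi_inv_pow_le` — the tail integral `∫_T^∞ dt/t^{k+1} ≤ 1/(k T^k)` (`k ≥ 1`)
  (for the vertical-line majorant `∫ dt/|σ+it|^{k+1} ≤ π/|σ|^k` see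
  `Literature.NumberTheory.Sieve.GPY.inv_norm_pow_le` / `integral_inv_sq_add_sq` in
  `GoldstonPintzYildirimShift.lean`).

These are the contour-integration primitives behind iterated residue computations such as
Goldston–Pintz–Yıldırım's Lemma 3 (§8 of *Primes in tuples I*), where a double line integral is
decomposed into rectangle pieces with poles at `s₁ = 0`, `s₂ = 0`, `s₁ + s₂ = 0`.

## References

* L. V. Ahlfors, *Complex Analysis*, 3rd ed., McGraw–Hill 1979, Ch. 4 §§1.4, 4.4–4.5 (Cauchy's
  theorem for rectangles and multiply connected regions); folklore. [folklore]
-/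

noncomputable section

open MeasureTheory Set Metric Filter intervalIntegral
open _root_.Complex _root_.Topology

namespace Literature.Analysis.Complex

variable {a b c d : ℝ}

/-! ### Two holes -/

/-- **Two holes separated by a vertical line.** Let `R = [a,b] × [c,d]`, and
`Rⱼ = [aⱼ,bⱼ] × [cⱼ,dⱼ] ⊆ R` (`j = 1, 2`) with `b₁ ≤ m ≤ a₂` for some `m`. If `F` is complex
differentiable on `R ∖ (R₁° ∪ R₂°)`, then `∮_{∂R} F = ∮_{∂R₁} F + ∮_{∂R₂} F`. [folklore] -/
theorem rectBoundaryIntegral_eq_add_of_differentiableOn_two_holes_re {F : ℂ → ℂ}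
    {a₁ b₁ c₁ d₁ a₂ b₂ c₂ d₂ m : ℝ}
    (ha₁ : a ≤ a₁) (hab₁ : a₁ < b₁) (hb₁ : b₁ ≤ m) (hma₂ : m ≤ a₂) (hab₂ : a₂ < b₂) (hb₂ : b₂ ≤ b)
    (hc₁ : c ≤ c₁) (hcd₁ : c₁ < d₁) (hd₁ : d₁ ≤ d) (hc₂ : c ≤ c₂) (hcd₂ : c₂ < d₂) (hd₂ : d₂ ≤ d)
    (hF : DifferentiableOn ℂ F
      ((Icc a b ×ℂ Icc c d) \ ((Ioo a₁ b₁ ×ℂ Ioo c₁ d₁) ∪ (Ioo a₂ b₂ ×ℂ Ioo c₂ d₂)))) :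
    rectBoundaryIntegral F a b c d =
      rectBoundaryIntegral F a₁ b₁ c₁ d₁ + rectBoundaryIntegral F a₂ b₂ c₂ d₂ := by
  have ham : a ≤ m := ha₁.trans (hab₁.le.trans hb₁)
  have hmb : m ≤ b := hma₂.trans (hab₂.le.trans hb₂)
  have hcd : c ≤ d := hc₁.trans (hcd₁.le.trans hd₁)
  set A : Set ℂ := (Icc a b ×ℂ Icc c d) \ ((Ioo a₁ b₁ ×ℂ Ioo c₁ d₁) ∪ (Ioo a₂ b₂ ×ℂ Ioo c₂ d₂))
    with hA
  have hcont : ContinuousOn F A := hF.continuousOn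
  -- the bottom and top edges of `R` lie in `A`
  have hbot : ∀ x ∈ Icc a b, ((x : ℂ) + c * I) ∈ A := by
    intro x hx
    refine ⟨⟨by simpa using hx, by simp [hcd]⟩, ?_⟩
    rintro (h | h)
    · have : c₁ < c := by simpa using h.2.1
      linarith
    · have : c₂ < c := by simpa using h.2.1
      linarith
  have htop : ∀ x ∈ Icc a b, ((x : ℂ) + d * I) ∈ A := by
    intro x hx
    refine ⟨⟨by simpa using hx, by simp [hcd]⟩, ?_⟩
    rintro (h | h)
    · have : d < d₁ := by simpa using h.2.2
      linarith
    · have : d < d₂ := by simpa using h.2.2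
      linarith
  rw [rectBoundaryIntegral_split_re ham hmb
    (intervalIntegrable_horizontal_of_continuousOn hcont c (ham.trans hmb) hbot)
    (intervalIntegrable_horizontal_of_continuousOn hcont d (ham.trans hmb) htop)]
  congr 1
  · refine rectBoundaryIntegral_eq_of_differentiableOn_annulus ha₁ hab₁ hb₁ hc₁ hcd₁ hd₁
      (hF.mono ?_)
    rintro z ⟨⟨hzre, hzim⟩, hz⟩
    refine ⟨⟨⟨hzre.1, hzre.2.trans hmb⟩, hzim⟩, ?_⟩
    rintro (h | h)
    · exact hz ⟨h.1, h.2⟩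
    · have h1 : a₂ < z.re := h.1.1
      have h2 : z.re ≤ m := hzre.2
      linarith
  · refine rectBoundaryIntegral_eq_of_differentiableOn_annulus hma₂ hab₂ hb₂ hc₂ hcd₂ hd₂
      (hF.mono ?_)
    rintro z ⟨⟨hzre, hzim⟩, hz⟩
    refine ⟨⟨⟨ham.trans hzre.1, hzre.2⟩, hzim⟩, ?_⟩
    rintro (h | h)
    · have h1 : z.re < b₁ := h.1.2
      have h2 : m ≤ z.re := hzre.1
      linarith
    · exact hz ⟨h.1, h.2⟩

/-- **Two holes separated by a horizontal line.** As above with `d₁ ≤ m ≤ c₂`. [folklore] -/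
theorem rectBoundaryIntegral_eq_add_of_differentiableOn_two_holes_im {F : ℂ → ℂ}
    {a₁ b₁ c₁ d₁ a₂ b₂ c₂ d₂ m : ℝ}
    (ha₁ : a ≤ a₁) (hab₁ : a₁ < b₁) (hb₁ : b₁ ≤ b) (ha₂ : a ≤ a₂) (hab₂ : a₂ < b₂) (hb₂ : b₂ ≤ b)
    (hc₁ : c ≤ c₁) (hcd₁ : c₁ < d₁) (hd₁ : d₁ ≤ m) (hmc₂ : m ≤ c₂) (hcd₂ : c₂ < d₂) (hd₂ : d₂ ≤ d)
    (hF : DifferentiableOn ℂ F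
      ((Icc a b ×ℂ Icc c d) \ ((Ioo a₁ b₁ ×ℂ Ioo c₁ d₁) ∪ (Ioo a₂ b₂ ×ℂ Ioo c₂ d₂)))) :
    rectBoundaryIntegral F a b c d =
      rectBoundaryIntegral F a₁ b₁ c₁ d₁ + rectBoundaryIntegral F a₂ b₂ c₂ d₂ := by
  have hcm : c ≤ m := hc₁.trans (hcd₁.le.trans hd₁)
  have hmd : m ≤ d := hmc₂.trans (hcd₂.le.trans hd₂)
  have hab : a ≤ b := ha₁.trans (hab₁.le.trans hb₁)
  set A : Set ℂ := (Icc a b ×ℂ Icc c d) \ ((Ioo a₁ b₁ ×ℂ Ioo c₁ d₁) ∪ (Ioo a₂ b₂ ×ℂ Ioo c₂ d₂))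
    with hA
  have hcont : ContinuousOn F A := hF.continuousOn
  have hleft : ∀ y ∈ Icc c d, ((a : ℂ) + y * I) ∈ A := by
    intro y hy
    refine ⟨⟨by simp [hab], by simpa using hy⟩, ?_⟩
    rintro (h | h)
    · have : a₁ < a := by simpa using h.1.1
      linarith
    · have : a₂ < a := by simpa using h.1.1
      linarith
  have hright : ∀ y ∈ Icc c d, ((b : ℂ) + y * I) ∈ A := by
    intro y hy
    refine ⟨⟨by simp [hab], by simpa using hy⟩, ?_⟩
    rintro (h | h)
    · have : b < b₁ := by simpa using h.1.2
      linarith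
    · have : b < b₂ := by simpa using h.1.2
      linarith
  rw [rectBoundaryIntegral_split_im hcm hmd
    (intervalIntegrable_vertical_of_continuousOn hcont a (hcm.trans hmd) hleft)
    (intervalIntegrable_vertical_of_continuousOn hcont b (hcm.trans hmd) hright)]
  congr 1
  · refine rectBoundaryIntegral_eq_of_differentiableOn_annulus ha₁ hab₁ hb₁ hc₁ hcd₁ hd₁
      (hF.mono ?_)
    rintro z ⟨⟨hzre, hzim⟩, hz⟩
    refine ⟨⟨hzre, ⟨hzim.1, hzim.2.trans hmd⟩⟩, ?_⟩
    rintro (h | h)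
    · exact hz ⟨h.1, h.2⟩
    · have h1 : c₂ < z.im := h.2.1
      have h2 : z.im ≤ m := hzim.2
      linarith
  · refine rectBoundaryIntegral_eq_of_differentiableOn_annulus ha₂ hab₂ hb₂ hmc₂ hcd₂ hd₂
      (hF.mono ?_)
    rintro z ⟨⟨hzre, hzim⟩, hz⟩
    refine ⟨⟨hzre, ⟨hcm.trans hzim.1, hzim.2⟩⟩, ?_⟩
    rintro (h | h)
    · have h1 : z.im < d₁ := h.2.2
      have h2 : m ≤ z.im := hzim.1
      linarith
    · exact hz ⟨h.1, h.2⟩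

/-! ### Translation -/

/-- Translating the rectangle: `∮_{∂([a,b]×[c,d])} F(z + w) dz = ∮_{∂([a+Re w, b+Re w]×[c+Im w, d+Im w])} F`.
[folklore] -/
theorem rectBoundaryIntegral_comp_add (F : ℂ → ℂ) (w : ℂ) (a b c d : ℝ) :
    rectBoundaryIntegral (fun z => F (z + w)) a b c d =
      rectBoundaryIntegral F (a + w.re) (b + w.re) (c + w.im) (d + w.im) := by
  simp only [rectBoundaryIntegral]
  have h1 : ∀ y : ℝ, (∫ x : ℝ in a..b, F ((x : ℂ) + y * I + w)) =
      ∫ x : ℝ in (a + w.re)..(b + w.re), F ((x : ℂ) + ((y + w.im : ℝ) : ℂ) * I) := by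
    intro y
    rw [← intervalIntegral.integral_comp_add_right (fun x : ℝ => F ((x : ℂ) + ((y + w.im : ℝ) : ℂ) * I)) w.re]
    refine intervalIntegral.integral_congr fun x _ => ?_
    congr 1
    apply Complex.ext <;> simp
  have h2 : ∀ x : ℝ, (∫ y : ℝ in c..d, F ((x : ℂ) + y * I + w)) =
      ∫ y : ℝ in (c + w.im)..(d + w.im), F ((((x + w.re : ℝ)) : ℂ) + (y : ℂ) * I) := by
    intro x
    rw [← intervalIntegral.integral_comp_add_right (fun y : ℝ => F (((x + w.re : ℝ) : ℂ) + (y : ℂ) * I)) w.im]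
    refine intervalIntegral.integral_congr fun y _ => ?_
    congr 1
    apply Complex.ext <;> simp
  rw [h1 c, h1 d, h2 a, h2 b]

/-! ### Perimeter bound -/

/-- **Perimeter bound**: if `‖F z‖ ≤ M` at every point of the boundary of `[a,b] × [c,d]`
(`a ≤ b`, `c ≤ d`), then `‖∮_{∂R} F‖ ≤ M (2(b−a) + 2(d−c))`. [folklore] -/
theorem norm_rectBoundaryIntegral_le {F : ℂ → ℂ} (hab : a ≤ b) (hcd : c ≤ d) {M : ℝ}
    (hbot : ∀ x ∈ Icc a b, ‖F ((x : ℂ) + c * I)‖ ≤ M) (htop : ∀ x ∈ Icc a b, ‖F ((x : ℂ) + d * I)‖ ≤ M)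
    (hleft : ∀ y ∈ Icc c d, ‖F ((a : ℂ) + y * I)‖ ≤ M) (hright : ∀ y ∈ Icc c d, ‖F ((b : ℂ) + y * I)‖ ≤ M) :
    ‖rectBoundaryIntegral F a b c d‖ ≤ M * (2 * (b - a) + 2 * (d - c)) := by
  have e1 : ‖∫ x : ℝ in a..b, F ((x : ℂ) + c * I)‖ ≤ M * |b - a| :=
    intervalIntegral.norm_integral_le_of_norm_le_const fun x hx => hbot x (by
      rw [uIoc_of_le hab] at hx; exact ⟨hx.1.le, hx.2⟩)
  have e2 : ‖∫ x : ℝ in a..b, F ((x : ℂ) + d * I)‖ ≤ M * |b - a| :=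
    intervalIntegral.norm_integral_le_of_norm_le_const fun x hx => htop x (by
      rw [uIoc_of_le hab] at hx; exact ⟨hx.1.le, hx.2⟩)
  have e3 : ‖∫ y : ℝ in c..d, F ((b : ℂ) + y * I)‖ ≤ M * |d - c| :=
    intervalIntegral.norm_integral_le_of_norm_le_const fun y hy => hright y (by
      rw [uIoc_of_le hcd] at hy; exact ⟨hy.1.le, hy.2⟩)
  have e4 : ‖∫ y : ℝ in c..d, F ((a : ℂ) + y * I)‖ ≤ M * |d - c| :=
    intervalIntegral.norm_integral_le_of_norm_le_const fun y hy => hleft y (by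
      rw [uIoc_of_le hcd] at hy; exact ⟨hy.1.le, hy.2⟩)
  rw [abs_of_nonneg (sub_nonneg.2 hab)] at e1 e2
  rw [abs_of_nonneg (sub_nonneg.2 hcd)] at e3 e4
  rw [rectBoundaryIntegral]
  calc ‖(∫ x : ℝ in a..b, F (x + c * I)) - (∫ x : ℝ in a..b, F (x + d * I)) +
        I * (∫ y : ℝ in c..d, F (b + y * I)) - I * (∫ y : ℝ in c..d, F (a + y * I))‖
      ≤ ‖∫ x : ℝ in a..b, F (x + c * I)‖ + ‖∫ x : ℝ in a..b, F (x + d * I)‖ +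
          ‖I * ∫ y : ℝ in c..d, F (b + y * I)‖ + ‖I * ∫ y : ℝ in c..d, F (a + y * I)‖ := by
        refine (norm_sub_le _ _).trans ?_
        gcongr
        refine (norm_add_le _ _).trans ?_
        gcongr
        exact norm_sub_le _ _
    _ ≤ M * (b - a) + M * (b - a) + M * (d - c) + M * (d - c) := by
        rw [norm_mul, norm_mul, Complex.norm_I, one_mul, one_mul]
        gcongr
    _ = M * (2 * (b - a) + 2 * (d - c)) := by ring

/-! ### Holomorphic dependence on a parameter -/

/-- **Interval integrals depending holomorphically on a parameter.** Let `U ⊆ ℂ` be open,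
`g : ℂ → ℝ → ℂ` with `p ↦ g p x` complex differentiable on `U` for every `x ∈ [a, b]` and
`(p, x) ↦ g p x` continuous on `U × [a, b]`. Then `p ↦ ∫_a^b g p x dx` is complex differentiable
on `U` (dominated differentiation, with a constant majorant on small closed balls). [folklore] -/
theorem differentiableOn_intervalIntegral_of_continuousOn {g : ℂ → ℝ → ℂ} {U : Set ℂ}
    (hU : IsOpen U) (hab : a ≤ b) (hdiff : ∀ x ∈ Icc a b, DifferentiableOn ℂ (fun p => g p x) U)
    (hcont : ContinuousOn (Function.uncurry g) (U ×ˢ Icc a b)) :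
    DifferentiableOn ℂ (fun p => ∫ x in a..b, g p x) U := by
  -- rewrite as an integral over the restricted measure
  have heq : (fun p => ∫ x in a..b, g p x) = fun p => ∫ x, g p x ∂(volume.restrict (Ioc a b)) := by
    funext p; rw [intervalIntegral.integral_of_le hab]
  rw [heq]
  refine differentiableOn_integral_of_dominated ?_ ?_ ?_
  · -- measurability of the slices
    intro p hp
    have hc : ContinuousOn (fun x => g p x) (Icc a b) := by
      have : ContinuousOn (Function.uncurry g ∘ fun x : ℝ => (p, x)) (Icc a b) :=
        hcont.comp (by fun_prop) fun x hx => ⟨hp, hx⟩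
      exact this
    exact (hc.mono Ioc_subset_Icc_self).aestronglyMeasurable measurableSet_Ioc
  · -- differentiability in the parameter, for a.e. `x`
    rw [ae_restrict_iff' measurableSet_Ioc]
    exact Eventually.of_forall fun x hx => hdiff x (Ioc_subset_Icc_self hx)
  · -- local constant majorant
    intro p₀ hp₀
    obtain ⟨r, hr, hrU⟩ := Metric.isOpen_iff.1 hU p₀ hp₀
    have hK : IsCompact (closedBall p₀ (r / 2) ×ˢ Icc a b) :=
      (isCompact_closedBall p₀ (r / 2)).prod isCompact_Icc
    have hsub : closedBall p₀ (r / 2) ×ˢ Icc a b ⊆ U ×ˢ Icc a b :=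
      prod_mono ((closedBall_subset_ball (by linarith)).trans hrU) le_rfl
    obtain ⟨M, hM⟩ := hK.exists_bound_of_continuousOn (hcont.mono hsub)
    refine ⟨r / 2, by linarith, (ball_subset_closedBall).trans ((closedBall_subset_ball (by linarith)).trans hrU),
      fun _ => M, integrable_const _, ?_⟩
    rw [ae_restrict_iff' measurableSet_Ioc]
    refine Eventually.of_forall fun x hx p hp => ?_
    exact hM (p, x) ⟨ball_subset_closedBall hp, Ioc_subset_Icc_self hx⟩

/-- **Rectangle boundary integrals depending holomorphically on a parameter.** If, for every point
`z` of the boundary of `[a,b] × [c,d]`, `p ↦ F p z` is complex differentiable on the open set `U`,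
and `(p, z) ↦ F p z` is continuous on `U × S` for some set `S` containing the boundary, then
`p ↦ ∮_{∂R} F p` is complex differentiable on `U`. [folklore] -/
theorem differentiableOn_rectBoundaryIntegral {F : ℂ → ℂ → ℂ} {U S : Set ℂ} (hU : IsOpen U)
    (hab : a ≤ b) (hcd : c ≤ d)
    (hbd : ∀ z : ℂ, ((z.re ∈ Icc a b ∧ (z.im = c ∨ z.im = d)) ∨ (z.im ∈ Icc c d ∧ (z.re = a ∨ z.re = b))) → z ∈ S)
    (hdiff : ∀ z ∈ S, DifferentiableOn ℂ (fun p => F p z) U)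
    (hcont : ContinuousOn (Function.uncurry F) (U ×ˢ S)) :
    DifferentiableOn ℂ (fun p => rectBoundaryIntegral (F p) a b c d) U := by
  have hh : ∀ y : ℝ, (y = c ∨ y = d) →
      DifferentiableOn ℂ (fun p => ∫ x in a..b, F p ((x : ℂ) + y * I)) U := by
    intro y hy
    refine differentiableOn_intervalIntegral_of_continuousOn hU hab (fun x hx => hdiff _ ?_) ?_
    · exact hbd _ (Or.inl ⟨by simpa using hx, by simpa using hy⟩)
    · have : ContinuousOn (Function.uncurry F ∘ fun q : ℂ × ℝ => (q.1, ((q.2 : ℂ) + y * I)))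
          (U ×ˢ Icc a b) :=
        hcont.comp (by fun_prop) fun q hq => ⟨hq.1, hbd _ (Or.inl ⟨by simpa using hq.2, by simpa using hy⟩)⟩
      exact this
  have hv : ∀ x : ℝ, (x = a ∨ x = b) →
      DifferentiableOn ℂ (fun p => ∫ y in c..d, F p ((x : ℂ) + y * I)) U := by
    intro x hx
    refine differentiableOn_intervalIntegral_of_continuousOn hU hcd (fun y hy => hdiff _ ?_) ?_
    · exact hbd _ (Or.inr ⟨by simpa using hy, by simpa using hx⟩)
    · have : ContinuousOn (Function.uncurry F ∘ fun q : ℂ × ℝ => (q.1, ((x : ℂ) + (q.2 : ℂ) * I)))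
          (U ×ˢ Icc c d) :=
        hcont.comp (by fun_prop) fun q hq => ⟨hq.1, hbd _ (Or.inr ⟨by simpa using hq.2, by simpa using hx⟩)⟩
      exact this
  unfold rectBoundaryIntegral
  exact (((hh c (Or.inl rfl)).sub (hh d (Or.inr rfl))).add ((hv b (Or.inr rfl)).const_mul I)).sub
    ((hv a (Or.inl rfl)).const_mul I)

/-! ### A tail integral -/

/-- **Tails**: `∫_T^∞ dt/t^{k+1} = 1/(k T^k)` for `T > 0`, `k ≥ 1`; here as the bound
`∫_{(T,∞)} t^{-(k+1)} ≤ 1/(k T^k)` together with integrability. [folklore] -/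
theorem integral_Ioi_inv_pow_le {T : ℝ} (hT : 0 < T) {k : ℕ} (hk : 1 ≤ k) :
    IntegrableOn (fun t : ℝ => (t ^ (k + 1))⁻¹) (Ioi T) ∧
      ∫ t in Ioi T, (t ^ (k + 1))⁻¹ ≤ 1 / (k * T ^ k) := by
  have hlt : (-(k + 1 : ℝ)) < -1 := by
    have : (1 : ℝ) ≤ k := by exact_mod_cast hk
    linarith
  have hint := integrableOn_Ioi_rpow_of_lt hlt hT
  have heq : EqOn (fun t : ℝ => (t ^ (k + 1))⁻¹) (fun t : ℝ => t ^ (-(k + 1 : ℝ))) (Ioi T) := by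
    intro t ht
    have ht0 : 0 < t := hT.trans ht
    simp only
    rw [Real.rpow_neg ht0.le, ← Real.rpow_natCast]
    push_cast
    ring_nf
  refine ⟨hint.congr_fun heq.symm measurableSet_Ioi, ?_⟩
  rw [setIntegral_congr_fun measurableSet_Ioi heq, integral_Ioi_rpow_of_lt hlt hT]
  have hk0 : (0 : ℝ) < k := by exact_mod_cast hk
  have e : (-(k + 1 : ℝ)) + 1 = -(k : ℝ) := by ring
  rw [e, Real.rpow_neg hT.le, Real.rpow_natCast]
  have hTk : T ^ k ≠ 0 := pow_ne_zero _ hT.ne'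
  have : -(T ^ k)⁻¹ / -(k : ℝ) = 1 / (k * T ^ k) := by
    rw [neg_div_neg_eq]; field_simp
  rw [this]

end Literature.Analysis.Complex
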